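import Summits.Ventures.QEC.Census.CertCheckBZFast
import Summits.Ventures.QEC.Census.BB.BB144.BZAut4Data
import HarnessLib

/-!
# `BB144` — `bz_aut` certificate `bzAut4Data` (certA 27af9174ef991c5e, qec-search-10 4-block translation-orbit cover), side Z: KERNEL enumeration verdicts, file 01 (block 0, matrix 0, depth 4,
# part 1/1; emitted by qec-search-10 emit_std_enum.py in the cell-standard fast shape of qec-type-08's `Census/CertCheckBZFast.lean`)

Level-1 chunk ranges of the Brouwer–Zimmermann replay of matrix `G_0` of block 0 (first rows `i0 … i0+len−1`, budget 3 after
the first row): `chunk1RF (BB144.cert.bzTestZW wtGt11U) (BB144.cert.bzPosZ BB144.bzAut4Data 0 0) 3 i0 len = true` by `decide +kernel`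
(`maxHeartbeats 400000000` per declaration, director R12; ≤ 2000000 codewords per theorem and per file, type-08 01:05:18Z).
The fast scan `chunk1RF` and the unrolled weight test `wtGt11U` are EQUAL to the tree's `chunk1R` / `bzTestZ` (bridges
`chunk1RF_eq`, `bzTestZW_eq wtGt11U_eq`), so every theorem here is a statement about type-10's own words. Tier KERNEL-std,
axioms standard. The last part assembles `BB144.cert.bzZEnum BB144.bzAut4Data 0 0 = true` (`CertScanSplit.bzZEnum_of_scan`).
-/

namespace Summit.Ventures.QEC.Census.BB144

set_option maxHeartbeats 400000000 in
/-- Block 0, matrix 0, first rows 0 … 71 (budget 3 after the first row; 1091058 codewords): pass (fast scan, kernel). -/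
theorem enum4Z_0_0_r0 : chunk1RF (BB144.cert.bzTestZW wtGt11U) (BB144.cert.bzPosZ BB144.bzAut4Data 0 0) 3 0 72 = true := by
  decide +kernel

/-- Block 0, matrix 0: the BZ enumeration verdict ASSEMBLED from its 1 first-row ranges (tier KERNEL). -/
theorem enum4Z_0_0 : BB144.cert.bzZEnum BB144.bzAut4Data 0 0 = true :=
  BB144.cert.bzZEnum_of_scan BB144.bzAut4Data 0 0 (scan_origin_eq_true_of_chunk1 72 (by decide +kernel) (by decide +kernel)
    (forall_lt_append (forall_lt_zero) (forall_of_chunk1RF (BB144.cert.bzTestZW_eq wtGt11U_eq) enum4Z_0_0_r0)))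

end Summit.Ventures.QEC.Census.BB144
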